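import Summits.BirchSwinnertonDyer.Rank1Residual.X11b.AnticyclotomicControlMap
import Summits.BirchSwinnertonDyer.Rank1Residual.X11b.AnticyclotomicEmbedding
import Summits.BirchSwinnertonDyer.Rank1Residual.X11b.LocalTorsionMultiplicative
import Literature.NumberTheory.EllipticCurves.IwasawaTowerTorsionProofs
import HarnessLib

/-!
# Class X2 at a NON-SPLIT multiplicative prime: no `p`-torsion over `K`, none up the anticyclotomic
# tower, and injectivity of the control map — the first bricks of the control theorem (CTL) for
# O9 ∩ {non-split} WITHOUT irreducibility (cell `bsd-eis`, seat `bsd-eis-cgshw`; TARGET §6.2,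
# planner DECISION 2026-08-25T09:12Z; memo `cgshw-MEMO-2.md` Addendum A)

HONEST FRAMING (cell `bsd-eis`): theorems only (no definition, no named fact, no `sorry`); nothing
booked; X2 stays CONSTRUCTION-SHAPED. The X11b seats proved the anticyclotomic control theorem of
route R1 (`X11b.R1ControlOnTreeAt`, from Poitou–Tate atoms) under `Irr ∧ Ram`, which enters ONLY
through "`E(K)[p] = 0`" (`X11b.Transvection.forall_torsion_eq_zero_of_irr`,
`torsion_eq_zero_of_irr_of_ram`) and its consequences `E(K_∞)[p^∞] = 0`
(`fixedPoints_kerSubgroup_eq_bot_of_irr_of_ram`) and the injectivity of the control map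
(`controlMap_injective_of_irr_of_ram`). At an odd NON-SPLIT multiplicative prime `p` the same three
statements hold for EVERY `E` (any image of `E[p]`, in particular reducible = class X2) over every
number field `K` with a degree-one prime `𝔭 ∣ p` (e.g. a CGLS field, `p` split): `E(ℚ_p)[p] = 0`
(`X11b.LocalTorsion.localTorsion_eq_zero_of_nonsplit`, Silverman VII.6.1 / Ex. 3.5: `Ẽ_ns(𝔽_p)` has
`p + 1` points and the formal group no `p`-torsion) and `E(K) ↪ E(K_𝔭) = E(ℚ_p)`. This file records
them, so that the R1 control chain can be re-run on X2 ∩ {non-split} with `hivK` in place of `hirr`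
(next files).

* `forall_torsion_baseChange_eq_zero_of_not_split` — `E(K)[p] = 0`.
* `fixedPoints_kerSubgroup_eq_bot_of_not_split` — `E(K_∞)[p^∞] = 0` for every `ℤ_p`-extension
  `K_∞/K` (Greenberg's fixed-point principle, tree `fixedPoints_kerSubgroup_geomPrimaryTorsion_eq_bot`).
* `controlMap_injective_of_not_split`, `natCard_selmerAcBase_dvd_of_not_split` — JSW §3.3.2 first
  half on Castella's Selmer groups: `s : Sel_𝔮^Σ(K, E[p^∞]) → Sel_𝔮^Σ(K_∞, E[p^∞])^γ` injective, and the
  counting form.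

References: Silverman AEC VII.6.1, Ex. 3.5 [SilvermanAEC2009]; Greenberg LNM 1716 §1 p. 62, §3
Lemma 3.1 [GreenbergLNM1716]; Jetchev–Skinner–Wan 2017 §3.3 [JetchevSkinnerWan2017]; Keller–Yin
2024 App. B (the torsion-allowing control theorem, NOT needed here) [KellerYin2024].
-/

set_option autoImplicit false

noncomputable section

open scoped Classical

open WeierstrassCurve NumberField IsDedekindDomain Field Literature.NumberTheory.EllipticCurves
  Literature.NumberTheory.EllipticCurves.Rank1Residual

namespace Summit.BirchSwinnertonDyer.Rank1Residual.X2

variable (W : WeierstrassCurve ℚ) [W.IsElliptic] [W.IsGloballyMinimal] (p : ℕ) [Fact p.Prime]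

/-- **`E(K)[p] = 0` at a NON-SPLIT multiplicative `p ≥ 3`, for every number field `K` with a
degree-one prime `𝔭 ∣ p`** (no hypothesis on the image of `E[p]`): `E(K) ↪ E(K_𝔭) = E(ℚ_p)` along
THE embedding `embAt K p 𝔭` (injective on points), and `E(ℚ_p)[p] = 0`
(`X11b.LocalTorsion.localTorsion_eq_zero_of_nonsplit`). This is the hypothesis `hivK` of the X11b
Selmer-count chain, there derived from `Irr`. [cite: SilvermanAEC2009, VII.3 Prop. 3.1, Thm. VII.6.1 and Exercise 3.5] -/
theorem forall_torsion_baseChange_eq_zero_of_not_split (hp3 : 3 ≤ p) (hmult : Mult W p)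
    (hns : ¬ W.HasSplitMultiplicativeReductionAtPrime p)
    (K : Type) [Field K] [NumberField K] (𝔭 : HeightOneSpectrum (𝓞 K))
    (h𝔭 : ((p : ℕ) : 𝓞 K) ∈ 𝔭.asIdeal) (he : 𝔭.asIdeal.ramificationIdx (𝓞 ℚ) = 1)
    (hf : 𝔭.asIdeal.inertiaDeg (𝓞 ℚ) = 1) :
    ∀ P : (W.baseChange K).toAffine.Point, p • P = 0 → P = 0 := by
  intro P hP
  set ιp := X11b.embAt K p 𝔭 h𝔭 he hf with hιp
  set f : (W.baseChange K).toAffine.Point →+ (W.baseChange ℚ_[p]).toAffine.Point :=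
    Affine.Point.map (W' := W) ιp.toRatAlgHom with hfdef
  have hfinj : Function.Injective f := Affine.Point.map_injective (W' := W) ιp.toRatAlgHom
  have h0 : f P = 0 :=
    X11b.LocalTorsion.localTorsion_eq_zero_of_nonsplit W p hp3 hmult hns (f P)
      (by rw [← map_nsmul, hP, map_zero])
  exact (injective_iff_map_eq_zero f).mp hfinj P h0

/-- **`E(K_∞)[p^∞] = 0` up EVERY `ℤ_p`-extension of such a `K`** (Greenberg's fixed-point principle:
a pro-`p` group acting on a non-zero `p`-group fixes a non-zero `p`-torsion element; tree
`fixedPoints_kerSubgroup_geomPrimaryTorsion_eq_bot`). The X2 ∩ {non-split} twin of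
`X11b.fixedPoints_kerSubgroup_eq_bot_of_irr_of_ram`. [cite: GreenbergLNM1716, §1 p. 62; §4 p. 109] -/
theorem fixedPoints_kerSubgroup_eq_bot_of_not_split (hp3 : 3 ≤ p) (hmult : Mult W p)
    (hns : ¬ W.HasSplitMultiplicativeReductionAtPrime p)
    (K : Type) [Field K] [NumberField K] (𝔭 : HeightOneSpectrum (𝓞 K))
    (h𝔭 : ((p : ℕ) : 𝓞 K) ∈ 𝔭.asIdeal) (he : 𝔭.asIdeal.ramificationIdx (𝓞 ℚ) = 1)
    (hf : 𝔭.asIdeal.inertiaDeg (𝓞 ℚ) = 1) (κ : ZpExtension K p) :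
    FixedPoints.addSubgroup κ.kerSubgroup (geomPrimaryTorsion (W.baseChange K) p) = ⊥ := by
  haveI : (W.baseChange K).IsElliptic := by rw [baseChange]; infer_instance
  exact (W.baseChange K).fixedPoints_kerSubgroup_geomPrimaryTorsion_eq_bot κ
    (forall_torsion_baseChange_eq_zero_of_not_split W p hp3 hmult hns K 𝔭 h𝔭 he hf)

/-- **The control map is injective on X2 ∩ {non-split} data** (JSW17 §3.3.2 first half / Greenberg's
Lemma 3.1 with `B = 0`): for every `ℤ_p`-extension `κ` of such a `K` with a topological generator,
every distinguished prime `𝔮`, every `Σ` and every `γ`,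
`s : Sel_𝔮^Σ(K, E[p^∞]) → Sel_𝔮^Σ(K_∞, E[p^∞])^γ` is injective
(`X11b.AcSelmer.controlMap_injective_of_fixedPoints_eq_bot`). The X2 twin of
`X11b.controlMap_injective_of_irr_of_ram`. [cite: GreenbergLNM1716, §3 Lemma 3.1 (p. 86)] [cite: JetchevSkinnerWan2017, §3.3 (control; shape only)] -/
theorem controlMap_injective_of_not_split (hp3 : 3 ≤ p) (hmult : Mult W p)
    (hns : ¬ W.HasSplitMultiplicativeReductionAtPrime p)
    (K : Type) [Field K] [NumberField K] (𝔭 : HeightOneSpectrum (𝓞 K))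
    (h𝔭 : ((p : ℕ) : 𝓞 K) ∈ 𝔭.asIdeal) (he : 𝔭.asIdeal.ramificationIdx (𝓞 ℚ) = 1)
    (hf : 𝔭.asIdeal.inertiaDeg (𝓞 ℚ) = 1) (κ : ZpExtension K p) {γ₀ : absoluteGaloisGroup K}
    (hγ₀ : κ.IsTopGenerator γ₀) (𝔮 : HeightOneSpectrum (𝓞 K)) (S : Set (HeightOneSpectrum (𝓞 K)))
    (γ : absoluteGaloisGroup K) :
    Function.Injective (X11b.AcSelmer.controlMap (W.baseChange K) p κ 𝔮 S γ) :=
  X11b.AcSelmer.controlMap_injective_of_fixedPoints_eq_bot hγ₀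
    (fixedPoints_kerSubgroup_eq_bot_of_not_split W p hp3 hmult hns K 𝔭 h𝔭 he hf κ) γ

/-- **Counting form on X2 ∩ {non-split} data**: if `Sel_𝔮^Σ(K_∞, E[p^∞])^γ` is finite then Castella's
Selmer group over `K` is finite and `#Sel_𝔮^Σ(K, E[p^∞]) ∣ #Sel_𝔮^Σ(K_∞, E[p^∞])^γ`
(`X11b.AcSelmer.natCard_selmerAcBase_dvd_of_injective`). [cite: JetchevSkinnerWan2017, §3.3 (control; shape only)] -/
theorem natCard_selmerAcBase_dvd_of_not_split (hp3 : 3 ≤ p) (hmult : Mult W p)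
    (hns : ¬ W.HasSplitMultiplicativeReductionAtPrime p)
    (K : Type) [Field K] [NumberField K] (𝔭 : HeightOneSpectrum (𝓞 K))
    (h𝔭 : ((p : ℕ) : 𝓞 K) ∈ 𝔭.asIdeal) (he : 𝔭.asIdeal.ramificationIdx (𝓞 ℚ) = 1)
    (hf : 𝔭.asIdeal.inertiaDeg (𝓞 ℚ) = 1) (κ : ZpExtension K p) {γ₀ : absoluteGaloisGroup K}
    (hγ₀ : κ.IsTopGenerator γ₀) (𝔮 : HeightOneSpectrum (𝓞 K)) (S : Set (HeightOneSpectrum (𝓞 K)))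
    (γ : absoluteGaloisGroup K)
    [Finite (IwasawaDual.endInvariants
      (X11b.AcSelmer.conjSelmerAc (W.baseChange K) p κ 𝔮 S γ - 1))] :
    Finite (X11b.AcSelmer.selmerAcBase (W.baseChange K) p 𝔮 S) ∧
      Nat.card (X11b.AcSelmer.selmerAcBase (W.baseChange K) p 𝔮 S) ∣
        Nat.card (IwasawaDual.endInvariants
          (X11b.AcSelmer.conjSelmerAc (W.baseChange K) p κ 𝔮 S γ - 1)) :=
  X11b.AcSelmer.natCard_selmerAcBase_dvd_of_injective γ
    (controlMap_injective_of_not_split W p hp3 hmult hns K 𝔭 h𝔭 he hf κ hγ₀ 𝔮 S γ)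

end Summit.BirchSwinnertonDyer.Rank1Residual.X2

end
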